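import Mathlib
import Literature.MathematicalPhysics.StatisticalMechanics.LennardJonesClusters

/-!
# Crux `ExactCertificate` (stmt-AtomisticToContinuum-11959), line `closure-makes-nogap-exact`:
# the closure lemma `stub_closure`

At a fixed range `ρ`, the set of values `c + f 0 / 2` of the three-cone splits
`V_LJ = g + U + f` on `(0,∞)` — `U ≥ 0` on `(0,∞)`, `g ≡ 0` on `[ρ,∞)`, `f` radially of positive
type on `ℝ³` in the sense of finite quadratic forms, `g` `c`-stable on finite injective
configurations — is closed at every level `v`: if for every `ε > 0` there is a split of value
`≤ v + ε`, then there is a split of value `≤ v` (`stub_closure`, the registered stub of the line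
skeleton; no periodic configuration and no ground-state energy enter).

Proof (pointwise ultralimit).  Choose splits `S_k = (c_k, g_k, U_k, f_k)` of value
`≤ v + 1/(k+1) ≤ v + 1 =: M`.  Every split obeys the a-priori bounds of `split_bounds`:
`0 ≤ c` (one particle has no `g`-energy), `0 ≤ f 0` and `|f r| ≤ f 0` for `r ≥ 0` (the one- and
two-point quadratic forms), `−2c ≤ g r` for `r > 0` (two particles at distance `r`), whence with
`V_LJ = g + U + f` and `U ≥ 0`: `|c| ≤ M`, `|f r| ≤ 2M` (`r ≥ 0`), `|g r|, |U r| ≤ |V_LJ r| + 4M`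
(`r > 0`), uniformly in `k`.  Along a non-principal ultrafilter `𝒰` on `ℕ` every bounded real
sequence converges to its `limUnder` (`tendsto_limUnder_of_abs_le`, compactness of `[−B, B]`), so
`c := lim_𝒰 c_k`, `g r := lim_𝒰 g_k r`, `U r := lim_𝒰 U_k r`, `f r := lim_𝒰 f_k r` are genuine
limits wherever a clause evaluates them (`g, U` at `r > 0`, `f` at distances `r ≥ 0`, and `g` on
`[ρ,∞)` where the sequence is constantly `0`); every clause is a finite linear (in)equality between
such values, hence passes to the limit, and `c_k + f_k 0 / 2 ≤ v + 1/(k+1) → v` gives the value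
bound.  The two-point computations are adapted from the crux work file
`Cruxes/ExactCertificate/Disproof.lean` §1.  All `[folklore]`.
-/

noncomputable section

namespace Summit.AtomisticToContinuum.Crystallization.Theorems.ThreeConeCertificateExactCertificate

open Literature.MathematicalPhysics.StatisticalMechanics
open Filter Topology
open scoped BigOperators

/-! ## Two-point configurations -/

-- adapted from Cruxes/ExactCertificate/Disproof.lean §1 (`interactionEnergy_two`)
/-- The energy of a two-point configuration is its single pair term. [folklore] -/
private theorem interactionEnergy_pair (V : ℝ → ℝ) (a b : EuclideanSpace ℝ (Fin 3)) :
    interactionEnergy V ![a, b] = V (dist a b) := by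
  unfold interactionEnergy
  have h0 : Finset.Ioi (0 : Fin 2) = {1} := by decide
  have h1 : Finset.Ioi (1 : Fin 2) = ∅ := by decide
  simp [Fin.sum_univ_two, h0, h1]

/-- A two-point configuration of distinct points is injective. [folklore] -/
private theorem pair_injective {a b : EuclideanSpace ℝ (Fin 3)} (h : a ≠ b) :
    Function.Injective ![a, b] := by
  intro i j hij
  fin_cases i <;> fin_cases j
  · rfl
  · exact absurd hij (by simpa using h)
  · exact absurd hij (by simpa using h.symm)
  · rfl

-- adapted from Cruxes/ExactCertificate/Disproof.lean §1 (`quad_two`)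
/-- The two-point quadratic form of a radial kernel with weights `(1, s)`. [folklore] -/
private theorem quadForm_pair (f : ℝ → ℝ) (a b : EuclideanSpace ℝ (Fin 3)) (s : ℝ) :
    ∑ i : Fin 2, ∑ j : Fin 2, (![1, s] i) * (![1, s] j) * f (dist ((![a, b]) i) ((![a, b]) j))
      = (1 + s ^ 2) * f 0 + 2 * s * f (dist a b) := by
  simp only [Fin.sum_univ_two, Matrix.cons_val_zero, Matrix.cons_val_one, dist_self,
    dist_comm b a]
  ring

/-- The point `r • e₀` of `ℝ³` is at distance `|r|` from the origin. [folklore] -/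
private theorem dist_zero_single (r : ℝ) :
    dist (0 : EuclideanSpace ℝ (Fin 3)) (EuclideanSpace.single 0 r) = |r| := by
  rw [dist_comm, dist_zero_right, PiLp.norm_single, Real.norm_eq_abs]

/-! ## A-priori bounds on a split -/

/-- **A-priori bounds on a three-cone split.**  If `V_LJ = g + U + f` on `(0,∞)` with `U ≥ 0`
there, `f` radially of positive type (finite quadratic forms) and `g` `c`-stable on finite
injective configurations, and the value satisfies `c + f 0 / 2 ≤ M`, then `|c| ≤ M`,
`|f r| ≤ 2M` for `r ≥ 0`, and `|g r|, |U r| ≤ |V_LJ r| + 4M` for `r > 0`.  (One particle: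
`0 ≤ c`; the one-point form: `0 ≤ f 0`; the two-point forms with weights `(1, ±1)`:
`|f r| ≤ f 0`; two particles at distance `r`: `−2c ≤ g r`.) [folklore] -/
private theorem split_bounds {c M : ℝ} {g U f : ℝ → ℝ}
    (h1 : ∀ r : ℝ, 0 < r → lennardJones r = g r + U r + f r)
    (h2 : ∀ r : ℝ, 0 < r → 0 ≤ U r)
    (h4 : ∀ (n : ℕ) (y : Fin n → EuclideanSpace ℝ (Fin 3)) (w : Fin n → ℝ),
      0 ≤ ∑ i, ∑ j, w i * w j * f (dist (y i) (y j)))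
    (h5 : ∀ (N : ℕ) (x : Fin N → EuclideanSpace ℝ (Fin 3)), Function.Injective x →
      -(c * (N : ℝ)) ≤ interactionEnergy g x)
    (hv : c + f 0 / 2 ≤ M) :
    |c| ≤ M ∧ (∀ r : ℝ, 0 ≤ r → |f r| ≤ 2 * M) ∧
      (∀ r : ℝ, 0 < r → |g r| ≤ |lennardJones r| + 4 * M) ∧
      (∀ r : ℝ, 0 < r → |U r| ≤ |lennardJones r| + 4 * M) := by
  -- one particle has no `g`-energy: `0 ≤ c`
  have hc : 0 ≤ c := by
    have h := h5 1 (fun _ => 0) fun i j _ => Subsingleton.elim i j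
    rw [interactionEnergy_of_subsingleton] at h
    simpa using h
  -- the one-point form: `0 ≤ f 0`
  have hf0 : 0 ≤ f 0 := by simpa using h4 1 (fun _ => 0) fun _ => 1
  -- the two-point forms with weights `(1, 1)` and `(1, -1)`: `|f r| ≤ f 0` for `r ≥ 0`
  have hfle : ∀ r : ℝ, 0 ≤ r → |f r| ≤ f 0 := fun r hr => by
    have hp := h4 2 ![0, EuclideanSpace.single 0 r] ![1, 1]
    have hm := h4 2 ![0, EuclideanSpace.single 0 r] ![1, -1]
    rw [quadForm_pair, dist_zero_single, abs_of_nonneg hr] at hp hm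
    norm_num at hp hm
    rw [abs_le]
    constructor <;> linarith
  -- two particles at distance `r > 0`: `-2c ≤ g r`
  have hg : ∀ r : ℝ, 0 < r → -(2 * c) ≤ g r := fun r hr => by
    have hne : (0 : EuclideanSpace ℝ (Fin 3)) ≠ EuclideanSpace.single 0 r := by
      rw [← dist_pos, dist_zero_single]
      exact abs_pos.2 hr.ne'
    have h := h5 2 _ (pair_injective hne)
    rw [interactionEnergy_pair, dist_zero_single, abs_of_pos hr] at h
    push_cast at h
    linarith
  refine ⟨?_, fun r hr => ?_, fun r hr => ?_, fun r hr => ?_⟩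
  · rw [abs_le]
    constructor <;> linarith
  · linarith [hfle r hr]
  · have e1 := h1 r hr
    have e2 := h2 r hr
    have e3 := abs_le.1 (hfle r hr.le)
    have e4 := hg r hr
    rw [abs_le]
    constructor <;>
      linarith [abs_nonneg (lennardJones r), le_abs_self (lennardJones r), e3.1, e3.2]
  · have e1 := h1 r hr
    have e2 := h2 r hr
    have e3 := abs_le.1 (hfle r hr.le)
    have e4 := hg r hr
    rw [abs_le]
    constructor <;>
      linarith [abs_nonneg (lennardJones r), le_abs_self (lennardJones r), e3.1, e3.2]

/-! ## Ultralimits of bounded real sequences -/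

/-- Along an ultrafilter on `ℕ`, a bounded real sequence converges (to its `limUnder`):
`[−B, B]` is compact. [folklore] -/
private theorem tendsto_limUnder_of_abs_le (𝒰 : Ultrafilter ℕ) {u : ℕ → ℝ} {B : ℝ}
    (h : ∀ k, |u k| ≤ B) : Tendsto u (𝒰 : Filter ℕ) (𝓝 (limUnder (𝒰 : Filter ℕ) u)) := by
  obtain ⟨x, -, hx⟩ := (isCompact_Icc (a := -B) (b := B)).ultrafilter_le_nhds' (𝒰.map u)
    (Ultrafilter.mem_map.2 (univ_mem' fun k => abs_le.1 (h k)))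
  rw [Ultrafilter.coe_map] at hx
  exact tendsto_nhds_limUnder ⟨x, hx⟩

/-! ## The closure lemma -/

/-- **`stub_closure` — the three certificate cones are closed at every level (line
`closure-makes-nogap-exact` of crux `ExactCertificate`, stmt-AtomisticToContinuum-11959).**
At a fixed range `ρ`: if for every `ε > 0` there is a split `V_LJ = g + U + f` on `(0,∞)` with
`U ≥ 0` on `(0,∞)`, `g ≡ 0` on `[ρ,∞)`, `f` radially of positive type on `ℝ³` (finite quadratic
forms), `g` `c`-stable on finite injective configurations, and value `c + f 0 / 2 ≤ v + ε`, then
there is such a split of value `≤ v`.  Proof: pointwise limit along a non-principal ultrafilter of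
near-optimal splits, which are uniformly bounded at every evaluated point by `split_bounds`; each
clause is a finite linear (in)equality in point values and passes to the limit. [folklore] -/
theorem stub_closure : ∀ (ρ v : ℝ),
    (∀ ε : ℝ, 0 < ε → ∃ (c : ℝ) (g U f : ℝ → ℝ),
      ((∀ r : ℝ, 0 < r → lennardJones r = g r + U r + f r) ∧
        (∀ r : ℝ, 0 < r → 0 ≤ U r) ∧
        (∀ r : ℝ, ρ ≤ r → g r = 0) ∧
        (∀ (n : ℕ) (y : Fin n → EuclideanSpace ℝ (Fin 3)) (w : Fin n → ℝ),
          0 ≤ ∑ i, ∑ j, w i * w j * f (dist (y i) (y j))) ∧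
        (∀ (N : ℕ) (x : Fin N → EuclideanSpace ℝ (Fin 3)), Function.Injective x →
          -(c * (N : ℝ)) ≤ interactionEnergy g x)) ∧
      c + f 0 / 2 ≤ v + ε) →
    ∃ (c : ℝ) (g U f : ℝ → ℝ),
      ((∀ r : ℝ, 0 < r → lennardJones r = g r + U r + f r) ∧
        (∀ r : ℝ, 0 < r → 0 ≤ U r) ∧
        (∀ r : ℝ, ρ ≤ r → g r = 0) ∧
        (∀ (n : ℕ) (y : Fin n → EuclideanSpace ℝ (Fin 3)) (w : Fin n → ℝ),
          0 ≤ ∑ i, ∑ j, w i * w j * f (dist (y i) (y j))) ∧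
        (∀ (N : ℕ) (x : Fin N → EuclideanSpace ℝ (Fin 3)), Function.Injective x →
          -(c * (N : ℝ)) ≤ interactionEnergy g x)) ∧
      c + f 0 / 2 ≤ v := by
  intro ρ v H
  -- near-optimal splits `S_k = (c k, g k, U k, f k)` of value `≤ v + 1/(k+1)`
  choose c g U f hS hv using fun k : ℕ => H (1 / ((k : ℝ) + 1)) Nat.one_div_pos_of_nat
  -- uniform bounds at every evaluated point, with `M := v + 1`
  have hB : ∀ k, |c k| ≤ v + 1 ∧ (∀ r : ℝ, 0 ≤ r → |f k r| ≤ 2 * (v + 1)) ∧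
      (∀ r : ℝ, 0 < r → |g k r| ≤ |lennardJones r| + 4 * (v + 1)) ∧
      (∀ r : ℝ, 0 < r → |U k r| ≤ |lennardJones r| + 4 * (v + 1)) := fun k => by
    have hk : (1 : ℝ) ≤ (k : ℝ) + 1 := le_add_of_nonneg_left k.cast_nonneg
    exact split_bounds (hS k).1 (hS k).2.1 (hS k).2.2.2.1 (hS k).2.2.2.2 ((hv k).trans
      (add_le_add le_rfl (div_le_one_of_le₀ hk (zero_le_one.trans hk))))
  -- a non-principal ultrafilter on `ℕ` and the pointwise ultralimits
  obtain ⟨𝒰, h𝒰⟩ : ∃ 𝒰 : Ultrafilter ℕ, (𝒰 : Filter ℕ) ≤ atTop :=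
    ⟨hyperfilter ℕ, hyperfilter_le_cofinite.trans Nat.cofinite_eq_atTop.le⟩
  have hc : Tendsto c (𝒰 : Filter ℕ) (𝓝 (limUnder (𝒰 : Filter ℕ) c)) :=
    tendsto_limUnder_of_abs_le 𝒰 fun k => (hB k).1
  have hf : ∀ r : ℝ, 0 ≤ r →
      Tendsto (fun k => f k r) (𝒰 : Filter ℕ) (𝓝 (limUnder (𝒰 : Filter ℕ) fun k => f k r)) :=
    fun r hr => tendsto_limUnder_of_abs_le 𝒰 fun k => (hB k).2.1 r hr
  have hg : ∀ r : ℝ, 0 < r →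
      Tendsto (fun k => g k r) (𝒰 : Filter ℕ) (𝓝 (limUnder (𝒰 : Filter ℕ) fun k => g k r)) :=
    fun r hr => tendsto_limUnder_of_abs_le 𝒰 fun k => (hB k).2.2.1 r hr
  have hU : ∀ r : ℝ, 0 < r →
      Tendsto (fun k => U k r) (𝒰 : Filter ℕ) (𝓝 (limUnder (𝒰 : Filter ℕ) fun k => U k r)) :=
    fun r hr => tendsto_limUnder_of_abs_le 𝒰 fun k => (hB k).2.2.2 r hr
  refine ⟨limUnder (𝒰 : Filter ℕ) c, fun r => limUnder (𝒰 : Filter ℕ) fun k => g k r,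
    fun r => limUnder (𝒰 : Filter ℕ) fun k => U k r, fun r => limUnder (𝒰 : Filter ℕ) fun k => f k r,
    ⟨fun r hr => ?_, fun r hr => ?_, fun r hr => ?_, fun n y w => ?_, fun N x hx => ?_⟩, ?_⟩
  · -- (S1) `V_LJ = g + U + f` on `(0,∞)`: limit of a constant sequence
    exact tendsto_nhds_unique (tendsto_const_nhds.congr fun k => (hS k).1 r hr)
      (((hg r hr).add (hU r hr)).add (hf r hr.le))
  · -- (S2) `U ≥ 0` on `(0,∞)`
    exact ge_of_tendsto' (hU r hr) fun k => (hS k).2.1 r hr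
  · -- (S3) `g ≡ 0` on `[ρ,∞)`: the sequence is constantly `0`
    exact (tendsto_const_nhds.congr fun k => ((hS k).2.2.1 r hr).symm).limUnder_eq
  · -- (S4) positive type: finite quadratic forms pass to the limit (all distances are `≥ 0`)
    have hT : Tendsto (fun k => ∑ i, ∑ j, w i * w j * f k (dist (y i) (y j))) (𝒰 : Filter ℕ)
        (𝓝 (∑ i, ∑ j, w i * w j * limUnder (𝒰 : Filter ℕ) fun k => f k (dist (y i) (y j)))) :=
      tendsto_finsetSum _ fun i _ => tendsto_finsetSum _ fun j _ =>
        (hf (dist (y i) (y j)) dist_nonneg).const_mul (w i * w j)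
    exact ge_of_tendsto' hT fun k => (hS k).2.2.2.1 n y w
  · -- (S5) stability: finite energies pass to the limit (all distances are `> 0`)
    have hT : Tendsto (fun k => ∑ i, ∑ j ∈ Finset.Ioi i, g k (dist (x i) (x j))) (𝒰 : Filter ℕ)
        (𝓝 (∑ i, ∑ j ∈ Finset.Ioi i, limUnder (𝒰 : Filter ℕ) fun k => g k (dist (x i) (x j)))) :=
      tendsto_finsetSum _ fun i _ => tendsto_finsetSum _ fun j hj =>
        hg (dist (x i) (x j)) (dist_pos.2 fun h => (Finset.mem_Ioi.1 hj).ne' (hx h.symm))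
    exact le_of_tendsto_of_tendsto' (hc.mul_const (N : ℝ)).neg hT fun k => (hS k).2.2.2.2 N x hx
  · -- the value: `c_k + f_k 0 / 2 ≤ v + 1/(k+1) → v`
    have he : Tendsto (fun k : ℕ => v + 1 / ((k : ℝ) + 1)) (𝒰 : Filter ℕ) (𝓝 v) := by
      have h := (tendsto_one_div_add_atTop_nhds_zero_nat.mono_left h𝒰).const_add v
      rwa [add_zero] at h
    exact le_of_tendsto_of_tendsto' (hc.add ((hf 0 le_rfl).div_const 2)) he hv

end Summit.AtomisticToContinuum.Crystallization.Theorems.ThreeConeCertificateExactCertificate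

end
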